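import Mathlib
import HarnessLib

/-!
# Wohlfahrt's theorem: congruence subgroups of Wohlfahrt level `N` contain `Γ(N)`

K. Wohlfahrt, *An extension of F. Klein's level concept*, Illinois J. Math. **8** (1964), 529–535,
Theorem 2: for a congruence subgroup `G ≤ SL(2, ℤ)`, Klein's level (the least `N` with `Γ(N) ≤ G`)
equals Wohlfahrt's level (the least common multiple of the cusp widths). Equivalently: a congruence
subgroup all of whose cusp widths divide `N` contains `Γ(N)`. This is the group-theoretic input of
F. Calegari, V. Dimitrov, Y. Tang, *The unbounded denominators conjecture*, J. Amer. Math. Soc.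
**38** (2025), 627–702 (arXiv:2109.09040), §4.1 (Definition 17, "Wohlfahrt level") and the last
step of the proof of Lemma 30 ("the smallest congruence subgroup of Wohlfahrt level `N` containing
`E` is precisely `⟨E, Γ(N)⟩` by [Wohlfahrt]"); it is vendored here, fully proved, as a step toward
the named facts of `Literature/NumberTheory/Automorphic/UnboundedDenominators.lean`.

## Statements

* `Wohlfahrt.Gamma_le_of_isCongruenceSubgroup_of_forall_conj_T_pow_mem` — conjugation form:
  `IsCongruenceSubgroup G → (∀ g : SL(2, ℤ), g T^N g⁻¹ ∈ G) → Γ(N) ≤ G`.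
* `Wohlfahrt.Gamma_le_of_isCongruenceSubgroup_of_forall_mem_strictPeriods` — cusp-width form:
  the hypothesis phrased as "`N` is a strict period (Mathlib `Subgroup.strictPeriods`) of every
  conjugate `conjGL G g`, `g ∈ SL(2, ℤ)`", i.e. every cusp width of `G` divides `N`.
* `Wohlfahrt.Gamma_le_of_Gamma_le_of_forall_conj_T_pow_mem` — technical form with an explicit
  auxiliary level `L` (`Γ(L) ≤ G`, no divisibility between `N` and `L` required).

## Proof

Not Wohlfahrt's original argument but a direct one. For `γ ∈ Γ(N)` and `Γ(L) ≤ G`: a translate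
`γ₁ = T^{Nt} γ ∈ Γ(N)` has upper-left entry a unit mod `L` (prime avoidance over `ℤ`,
`exists_add_mul_isCoprime_natCast`, the argument of Mathlib's `ZMod.unitsMap_surjective`). In
`SL(2, ℤ/L)`, every matrix with entries `(1 + Nx, Nb₁; Nc₁, *)` and unit corner is the explicit
product `E₂₁(Nc₁e) · E₂₁(-Nxe) · h(x) · E₁₂(Nxe) · E₁₂(Neb₁)` of reductions of `SL(2, ℤ)`-conjugates
of powers of `T^N` (`mem_of_isUnit_of_congr`; `E₁₂(y) = T^y`, `E₂₁(y) = S T^{-y} S⁻¹`,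
`h(x) = U T^{-Nx} U⁻¹ = (1+Nx, -Nx; Nx, 1-Nx)`, `U = S T⁻¹ S⁻¹`, `(1 + Nx) e = 1`). Hence the
reduction of `γ₁` lies in the reduction of `G`, so `γ₁ ∈ G · Γ(L) = G`, and `γ = T^{-Nt} γ₁ ∈ G`.

## Not here

Wohlfahrt's level as a definition (lcm of cusp widths) and the equality of the two levels as
numbers; only the containment `Γ(N) ≤ G` that Calegari–Dimitrov–Tang use.
-/

noncomputable section

namespace Literature.NumberTheory.Automorphic

open scoped MatrixGroups ModularGroup Pointwise
open CongruenceSubgroup Matrix.SpecialLinearGroup ModularGroup ConjAct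

namespace Wohlfahrt

/-- Prime avoidance over `ℤ`: if `x` and `g` are coprime then some `x + k g` is coprime to the
non-zero natural number `m` (take for `k` the product of the primes dividing `m` but not `x`; the
argument of Mathlib's `ZMod.unitsMap_surjective`). [folklore] -/
theorem exists_add_mul_isCoprime_natCast {x g : ℤ} (hxg : IsCoprime x g) (m : ℕ) (hm : m ≠ 0) :
    ∃ k : ℤ, IsCoprime (x + k * g) m := by
  classical
  let ps : Finset ℕ := {p ∈ m.primeFactors | ¬ (p : ℤ) ∣ x}
  refine ⟨(ps.prod id : ℕ), ?_⟩
  rw [Int.isCoprime_iff_gcd_eq_one]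
  change Nat.Coprime (Int.natAbs (x + ((ps.prod id : ℕ) : ℤ) * g)) (Int.natAbs (m : ℤ))
  rw [Int.natAbs_natCast]
  apply Nat.coprime_of_dvd
  intro p pp hp hpm
  have hp' : (p : ℤ) ∣ x + (ps.prod id : ℕ) * g := Int.natCast_dvd.mpr hp
  have hpprime : Prime (p : ℤ) := Nat.prime_iff_prime_int.mp pp
  by_cases hpx : (p : ℤ) ∣ x
  · -- then `p ∉ ps`, so `p ∤ ∏ ps`, and `p ∤ g` by coprimality: contradiction
    have hpg : ¬ (p : ℤ) ∣ g := fun hpg ↦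
      hpprime.not_unit (hxg.isUnit_of_dvd' hpx hpg)
    have hprod : ¬ (p : ℤ) ∣ ((ps.prod id : ℕ) : ℤ) := by
      rw [Int.natCast_dvd_natCast, pp.prime.dvd_finsetProd_iff]
      rintro ⟨q, hq, hpq⟩
      rw [Finset.mem_filter, Nat.mem_primeFactors] at hq
      obtain rfl : p = q := (Nat.prime_dvd_prime_iff_eq pp hq.1.1).mp hpq
      exact hq.2 hpx
    have : (p : ℤ) ∣ ((ps.prod id : ℕ) : ℤ) * g := by
      simpa using (Int.dvd_sub hp' hpx)
    rcases hpprime.dvd_or_dvd this with h | h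
    · exact hprod h
    · exact hpg h
  · have pps : p ∈ ps :=
      Finset.mem_filter.mpr ⟨Nat.mem_primeFactors.mpr ⟨pp, hpm, hm⟩, hpx⟩
    have hprod : (p : ℤ) ∣ ((ps.prod id : ℕ) : ℤ) * g :=
      Dvd.dvd.mul_right (Int.natCast_dvd_natCast.mpr (Finset.dvd_prod_of_mem id pps)) g
    have : (p : ℤ) ∣ x := by simpa using Int.dvd_sub hp' hprod
    exact hpx this


/-- `Γ(L) ≤ Γ(M)` when `M ∣ L`. [folklore] -/
theorem Gamma_le_Gamma_of_dvd {M L : ℕ} (h : M ∣ L) : Gamma L ≤ Gamma M := by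
  intro γ hγ
  rw [Gamma_mem] at hγ ⊢
  have cast_eq : ∀ a : ℤ, ((a : ZMod L).cast : ZMod M) = (a : ZMod M) := fun a ↦
    ZMod.cast_intCast h a
  refine ⟨?_, ?_, ?_, ?_⟩
  · rw [← cast_eq, hγ.1, ZMod.cast_one h]
  · rw [← cast_eq, hγ.2.1, ZMod.cast_zero]
  · rw [← cast_eq, hγ.2.2.1, ZMod.cast_zero]
  · rw [← cast_eq, hγ.2.2.2, ZMod.cast_one h]

/-- The algebraic heart of Wohlfahrt's theorem, in `SL(2, ℤ/L)`: let `H ≤ SL(2, ℤ/L)` contain the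
reductions mod `L` of all `SL(2, ℤ)`-conjugates of all powers `T^{Nk}` of `T^N = (1 N; 0 1)`. Then
every `A ∈ SL(2, ℤ/L)` whose first column is `≡ (1, 0) (mod N)`, whose upper-right entry is
`≡ 0 (mod N)` and whose upper-left entry is a unit lies in `H`: explicitly
`A = E₂₁(Nc₁e) · (E₂₁(-Nxe) · h(x) · E₁₂(Nxe)) · E₁₂(Neb₁)` with `A₀₀ = 1 + Nx`, `(1 + Nx)e = 1`,
`A₀₁ = Nb₁`, `A₁₀ = Nc₁`, where `E₁₂(y) = T^y`, `E₂₁(y) = S T^{-y} S⁻¹` and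
`h(x) = U T^{-Nx} U⁻¹ = (1+Nx  -Nx; Nx  1-Nx)` for `U = S T⁻¹ S⁻¹ = (1 0; 1 1)`.
[cite: CalegariDimitrovTang2025, §4.1 (Wohlfahrt level), cf. Lemma 30] -/
theorem mem_of_isUnit_of_congr {L N : ℕ} (H : Subgroup SL(2, ZMod L))
    (hH : ∀ (g : SL(2, ℤ)) (k : ℤ),
      map (Int.castRingHom (ZMod L)) (g * T ^ ((N : ℤ) * k) * g⁻¹) ∈ H)
    (A : SL(2, ZMod L)) {x b₁ c₁ : ZMod L} (ha : A 0 0 = 1 + N * x) (hb : A 0 1 = N * b₁)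
    (hc : A 1 0 = N * c₁) (hu : IsUnit (A 0 0)) : A ∈ H := by
  -- every residue is the reduction of an integer
  have lift : ∀ r : ZMod L, ∃ k : ℤ, (k : ZMod L) = r := fun r ↦ ⟨r.cast, ZMod.intCast_zmod_cast r⟩
  -- (a) three families of elements of `H`, as explicit matrices
  have hE12 : ∀ r : ZMod L,
      (⟨!![1, (N : ZMod L) * r; 0, 1], by simp [Matrix.det_fin_two_of]⟩ : SL(2, ZMod L)) ∈ H := by
    intro r
    obtain ⟨k, rfl⟩ := lift r
    suffices heq : (⟨!![1, (N : ZMod L) * k; 0, 1], by simp [Matrix.det_fin_two_of]⟩ :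
        SL(2, ZMod L)) = map (Int.castRingHom (ZMod L)) (1 * T ^ ((N : ℤ) * k) * 1⁻¹) from
      heq ▸ hH 1 k
    ext i j
    rw [SL_reduction_mod_hom_val]
    simp only [one_mul, inv_one, mul_one, ModularGroup.coe_T_zpow]
    fin_cases i <;> fin_cases j <;> simp
  have hE21 : ∀ r : ZMod L,
      (⟨!![1, 0; (N : ZMod L) * r, 1], by simp [Matrix.det_fin_two_of]⟩ : SL(2, ZMod L)) ∈ H := by
    intro r
    obtain ⟨k, rfl⟩ := lift r
    suffices heq : (⟨!![1, 0; (N : ZMod L) * k, 1], by simp [Matrix.det_fin_two_of]⟩ :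
        SL(2, ZMod L)) = map (Int.castRingHom (ZMod L)) (S * T ^ ((N : ℤ) * (-k)) * S⁻¹) from
      heq ▸ hH S (-k)
    ext i j
    rw [SL_reduction_mod_hom_val]
    simp only [Matrix.SpecialLinearGroup.coe_mul, Matrix.SpecialLinearGroup.coe_inv,
      ModularGroup.coe_T_zpow, ModularGroup.coe_S, Matrix.adjugate_fin_two_of, Matrix.mul_fin_two]
    fin_cases i <;> fin_cases j <;> simp
  have hh : ∀ r : ZMod L,
      (⟨!![1 + (N : ZMod L) * r, -((N : ZMod L) * r); (N : ZMod L) * r, 1 - (N : ZMod L) * r],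
        by simp [Matrix.det_fin_two_of]; ring⟩ : SL(2, ZMod L)) ∈ H := by
    intro r
    obtain ⟨k, rfl⟩ := lift r
    suffices heq : (⟨!![1 + (N : ZMod L) * k, -((N : ZMod L) * k); (N : ZMod L) * k,
        1 - (N : ZMod L) * k], by simp [Matrix.det_fin_two_of]; ring⟩ : SL(2, ZMod L)) =
        map (Int.castRingHom (ZMod L))
          ((S * T⁻¹ * S⁻¹) * T ^ ((N : ℤ) * (-k)) * (S * T⁻¹ * S⁻¹)⁻¹) from
      heq ▸ hH (S * T⁻¹ * S⁻¹) (-k)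
    ext i j
    rw [SL_reduction_mod_hom_val]
    simp only [mul_inv_rev, inv_inv, Matrix.SpecialLinearGroup.coe_mul,
      Matrix.SpecialLinearGroup.coe_inv, ModularGroup.coe_T_zpow, ModularGroup.coe_S,
      ModularGroup.coe_T, Matrix.adjugate_fin_two_of, Matrix.mul_fin_two]
    fin_cases i <;> fin_cases j <;> simp
    all_goals ring
  -- (b) the inverse `e` of the corner entry and the diagonal matrix `diag(1 + Nx, e) ∈ H`
  obtain ⟨e, he⟩ : ∃ e : ZMod L, (1 + (N : ZMod L) * x) * e = 1 := by
    rw [← ha]; exact hu.exists_right_inv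
  let D : SL(2, ZMod L) := ⟨!![1 + (N : ZMod L) * x, 0; 0, e], by simp [Matrix.det_fin_two_of, he]⟩
  have hD : D ∈ H := by
    let X : SL(2, ZMod L) :=
      ⟨!![1, 0; (N : ZMod L) * (-(x * e)), 1], by simp [Matrix.det_fin_two_of]⟩
    let Y : SL(2, ZMod L) := ⟨!![1 + (N : ZMod L) * x, -((N : ZMod L) * x); (N : ZMod L) * x,
      1 - (N : ZMod L) * x], by simp [Matrix.det_fin_two_of]; ring⟩
    let Z : SL(2, ZMod L) := ⟨!![1, (N : ZMod L) * (x * e); 0, 1], by simp [Matrix.det_fin_two_of]⟩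
    have hmem : X * Y * Z ∈ H := H.mul_mem (H.mul_mem (hE21 (-(x * e))) (hh x)) (hE12 (x * e))
    suffices heq : D = X * Y * Z by rw [heq]; exact hmem
    ext i j
    fin_cases i <;> fin_cases j <;> simp [D, X, Y, Z]
    · linear_combination (-((N : ZMod L) * x)) * he
    · linear_combination ((N : ZMod L) * x) * he
    · linear_combination ((N : ZMod L) * x * ((N : ZMod L) * x * e - 1) + 1) * he
  -- (c) factor `A = E₂₁(N c₁ e) · diag(1 + Nx, e) · E₁₂(N e b₁)`
  have hdet : (1 + (N : ZMod L) * x) * A 1 1 - (N : ZMod L) * b₁ * ((N : ZMod L) * c₁) = 1 := by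
    have h := A.prop
    rw [Matrix.det_fin_two] at h
    rw [← ha, ← hb, ← hc]
    linear_combination h
  let X : SL(2, ZMod L) := ⟨!![1, 0; (N : ZMod L) * (c₁ * e), 1], by simp [Matrix.det_fin_two_of]⟩
  let Z : SL(2, ZMod L) := ⟨!![1, (N : ZMod L) * (e * b₁); 0, 1], by simp [Matrix.det_fin_two_of]⟩
  suffices heq : A = X * D * Z by
    rw [heq]; exact H.mul_mem (H.mul_mem (hE21 (c₁ * e)) hD) (hE12 (e * b₁))
  ext i j
  fin_cases i <;> fin_cases j <;> simp [D, X, Z, ha, hb, hc]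
  · linear_combination (-((N : ZMod L) * b₁)) * he
  · linear_combination (-((N : ZMod L) * c₁)) * he
  · linear_combination (-((N : ZMod L) * b₁ * ((N : ZMod L) * c₁) * e + A 1 1)) * he + e * hdet

/-- **Wohlfahrt's theorem** (K. Wohlfahrt, *An extension of F. Klein's level concept*, Illinois J.
Math. 8 (1964) 529–535, Thm. 2), in the form used by Calegari–Dimitrov–Tang (§4.1 and the last step
of the proof of Lemma 30: "the smallest congruence subgroup of Wohlfahrt level `N` containing `E`
is `⟨E, Γ(N)⟩`"), technical version with an explicit auxiliary level: if `G ≤ SL(2, ℤ)` contains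
`Γ(L)` for some `L ≠ 0` (no divisibility relation between `N` and `L` is needed), and contains every
`SL(2, ℤ)`-conjugate of `T^N` (i.e. every cusp of `G` has width dividing `N`), then `Γ(N) ≤ G`.
Proof: for `γ ∈ Γ(N)`, a suitable
`γ₁ = T^{Nt} γ` has upper-left entry a unit mod `L` (prime avoidance,
`exists_add_mul_isCoprime_natCast`); its reduction mod `L` lies in the reduction of `G` by
`mem_of_isUnit_of_congr`, so `γ₁ ∈ G · Γ(L) = G`.
[cite: CalegariDimitrovTang2025, §4.1 and Lemma 30] -/
theorem Gamma_le_of_Gamma_le_of_forall_conj_T_pow_mem {G : Subgroup SL(2, ℤ)} {N L : ℕ}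
    [NeZero L] (hL : Gamma L ≤ G)
    (hG : ∀ g : SL(2, ℤ), g * T ^ N * g⁻¹ ∈ G) : Gamma N ≤ G := by
  -- integer powers of the conjugates
  have hG' : ∀ (g : SL(2, ℤ)) (k : ℤ), g * T ^ ((N : ℤ) * k) * g⁻¹ ∈ G := by
    intro g k
    have h := Subgroup.zpow_mem G (hG g) k
    rwa [conj_zpow, ← zpow_natCast, ← zpow_mul] at h
  intro γ hγ
  have hγ' := hγ
  rw [Gamma_mem] at hγ'
  obtain ⟨h00, -, h10, -⟩ := hγ'
  -- Step 1: make the upper-left entry a unit mod `L`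
  have hcop : IsCoprime (γ 0 0 : ℤ) ((N : ℤ) * γ 1 0) := by
    refine IsCoprime.mul_right ?_ ?_
    · obtain ⟨q, hq⟩ :=
        (ZMod.intCast_eq_intCast_iff_dvd_sub 1 (γ 0 0) N).mp (by simpa using h00.symm)
      exact ⟨1, -q, by linear_combination hq⟩
    · have hdet := γ.prop
      rw [Matrix.det_fin_two] at hdet
      exact ⟨γ 1 1, -(γ 0 1), by linear_combination hdet⟩
  obtain ⟨t, ht⟩ := exists_add_mul_isCoprime_natCast hcop L (NeZero.ne L)
  set γ₁ : SL(2, ℤ) := T ^ ((N : ℤ) * t) * γ with hγ₁def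
  have hTt : T ^ ((N : ℤ) * t) ∈ Gamma N := by
    simpa using ModularGroup_T_pow_mem_Gamma (N : ℤ) ((N : ℤ) * t) (dvd_mul_right _ _)
  have hγ₁ : γ₁ ∈ Gamma N := mul_mem hTt hγ
  have hγ₁00 : (γ₁ 0 0 : ℤ) = γ 0 0 + t * ((N : ℤ) * γ 1 0) := by
    simp [hγ₁def, ModularGroup.coe_T_zpow, Matrix.mul_apply, Fin.sum_univ_two]
    ring
  have hu : IsUnit ((map (Int.castRingHom (ZMod L)) γ₁) 0 0) := by
    rw [SL_reduction_mod_hom_val, hγ₁00]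
    exact (ZMod.coe_int_isUnit_iff_isCoprime _ L).mpr ht.symm
  -- Step 2: the entries of `γ₁` mod `L` have the shape required by `mem_of_isUnit_of_congr`
  rw [Gamma_mem] at hγ₁
  obtain ⟨k00, k01, k10, -⟩ := hγ₁
  have shape1 : ∀ a : ℤ, ((a : ZMod N) = 1) → ∃ y : ZMod L, ((a : ℤ) : ZMod L) = 1 + N * y := by
    intro a ha1
    obtain ⟨q, hq⟩ := (ZMod.intCast_eq_intCast_iff_dvd_sub 1 a N).mp (by simpa using ha1.symm)
    refine ⟨(q : ZMod L), ?_⟩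
    rw [show a = 1 + N * q by linear_combination hq]
    push_cast; ring
  have shape0 : ∀ a : ℤ, ((a : ZMod N) = 0) → ∃ y : ZMod L, ((a : ℤ) : ZMod L) = N * y := by
    intro a ha0
    obtain ⟨q, hq⟩ := (ZMod.intCast_zmod_eq_zero_iff_dvd a N).mp ha0
    exact ⟨(q : ZMod L), by rw [hq]; push_cast; ring⟩
  obtain ⟨x, hx⟩ := shape1 _ k00
  obtain ⟨b₁, hb₁⟩ := shape0 _ k01
  obtain ⟨c₁, hc₁⟩ := shape0 _ k10
  -- Step 3: apply the algebraic lemma in `SL(2, ℤ/L)` to the image of `G`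
  have key : map (Int.castRingHom (ZMod L)) γ₁ ∈ G.map (map (Int.castRingHom (ZMod L))) :=
    mem_of_isUnit_of_congr (N := N) (G.map (map (Int.castRingHom (ZMod L))))
      (fun g k ↦ Subgroup.mem_map_of_mem _ (hG' g k)) (map (Int.castRingHom (ZMod L)) γ₁)
      (by rw [SL_reduction_mod_hom_val, hx]) (by rw [SL_reduction_mod_hom_val, hb₁])
      (by rw [SL_reduction_mod_hom_val, hc₁]) hu
  obtain ⟨g, hg, hgeq⟩ := Subgroup.mem_map.mp key
  have hker : g⁻¹ * γ₁ ∈ Gamma L := by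
    rw [Gamma_mem', map_mul, map_inv, hgeq, inv_mul_cancel]
  have hγ₁G : γ₁ ∈ G := by simpa using G.mul_mem hg (hL hker)
  -- Step 4: undo the translation
  have hT : T ^ ((N : ℤ) * t) ∈ G := by simpa using hG' 1 t
  have : γ = (T ^ ((N : ℤ) * t))⁻¹ * γ₁ := by simp [hγ₁def]
  rw [this]
  exact G.mul_mem (G.inv_mem hT) hγ₁G

/-- **Wohlfahrt's theorem** (Wohlfahrt 1964, Thm. 2; the form quoted in Calegari–Dimitrov–Tang,
proof of Lemma 30): a congruence subgroup `G ≤ SL(2, ℤ)` containing every `SL(2, ℤ)`-conjugate of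
`T^N` — i.e. all of whose cusp widths divide `N`, "Wohlfahrt level dividing `N`" for `G ∋ -1` —
contains `Γ(N)`. Equivalently: a congruence subgroup of Wohlfahrt level `N` has Klein level `N`.
Contrapositively this is the standard noncongruence criterion.
[cite: CalegariDimitrovTang2025, §4.1 and Lemma 30] -/
theorem Gamma_le_of_isCongruenceSubgroup_of_forall_conj_T_pow_mem {G : Subgroup SL(2, ℤ)}
    (hG : IsCongruenceSubgroup G) {N : ℕ} (hN : ∀ g : SL(2, ℤ), g * T ^ N * g⁻¹ ∈ G) :
    Gamma N ≤ G := by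
  obtain ⟨M, hM, hMG⟩ := hG
  haveI : NeZero M := ⟨hM⟩
  exact Gamma_le_of_Gamma_le_of_forall_conj_T_pow_mem (L := M) hMG hN


/-- For a subgroup `Λ ≤ SL(2, ℤ)` and `N : ℕ`: the real number `N` is a strict period of (the image
in `GL(2, ℝ)` of) `Λ`, in Mathlib's sense `Subgroup.strictPeriods`, iff `T^N ∈ Λ`. [folklore] -/
theorem natCast_mem_strictPeriods_iff_T_pow_mem {Λ : Subgroup SL(2, ℤ)} {N : ℕ} :
    (N : ℝ) ∈ (Λ : Subgroup (GL (Fin 2) ℝ)).strictPeriods ↔ T ^ N ∈ Λ := by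
  simp only [Subgroup.mem_strictPeriods_iff, Subgroup.mem_map, Units.ext_iff, mapGL_coe_matrix,
    map_apply_coe]
  constructor
  · rintro ⟨g, hg, hgeq⟩
    suffices hgT : g = T ^ (N : ℤ) by rw [hgT, zpow_natCast] at hg; exact hg
    ext i j
    have hij := congr_fun₂ hgeq i j
    rw [ModularGroup.coe_T_zpow]
    fin_cases i <;> fin_cases j
    · simpa using hij
    · simp only [Fin.zero_eta, Fin.mk_one, Matrix.of_apply, Matrix.cons_val', Matrix.cons_val_one,
        Matrix.cons_val_fin_one, Matrix.cons_val_zero]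
      have hij' : ((g 0 1 : ℤ) : ℝ) = (N : ℝ) := by simpa using hij
      exact_mod_cast hij'
    · simpa using hij
    · simpa using hij
  · intro h
    refine ⟨T ^ N, h, ?_⟩
    rw [← zpow_natCast, ModularGroup.coe_T_zpow]
    ext i j
    fin_cases i <;> fin_cases j <;> simp

/-- **Wohlfahrt's theorem, cusp-width form.** If `G ≤ SL(2, ℤ)` is a congruence subgroup and `N`
is a strict period of every conjugate `g⁻¹ G g` (`g ∈ SL(2, ℤ)`; Mathlib's `conjGL G g` and
`Subgroup.strictPeriods`) — i.e. the width of every cusp `g • ∞` of `G` divides `N` — then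
`Γ(N) ≤ G`. [cite: CalegariDimitrovTang2025, §4.1, Definition 17 and Lemma 30] -/
theorem Gamma_le_of_isCongruenceSubgroup_of_forall_mem_strictPeriods {G : Subgroup SL(2, ℤ)}
    (hG : IsCongruenceSubgroup G) {N : ℕ}
    (hN : ∀ g : SL(2, ℤ),
      (N : ℝ) ∈ ((conjGL G (g : GL (Fin 2) ℝ) : Subgroup SL(2, ℤ)) :
        Subgroup (GL (Fin 2) ℝ)).strictPeriods) :
    Gamma N ≤ G := by
  refine Gamma_le_of_isCongruenceSubgroup_of_forall_conj_T_pow_mem hG fun g ↦ ?_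
  have h := natCast_mem_strictPeriods_iff_T_pow_mem.mp (hN g)
  rw [conjGL_coe, Subgroup.mem_pointwise_smul_iff_inv_smul_mem, toConjAct_inv, inv_inv,
    toConjAct_smul] at h
  exact h

end Wohlfahrt

end Literature.NumberTheory.Automorphic

end
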